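import Summits.QuantumFields.YangMills.Theorems.BalabanUVNodesPortS1FibreGraphPointCoords
import Summits.QuantumFields.YangMills.Theorems.BalabanUVNodesPortS1ChartBlind
import Summits.QuantumFields.YangMills.Theorems.BalabanUVNodesN18LoopLipschitz

/-!
# NODE O port PT-A — FE-1's chart law (T1), brick (B-e)♯ of `Lines/pta_residueW-CHART-LAW-PROOF-PLAN-v1.md` §2: A CONFIGURATION WITH α-SMALL LOOPS SITS IN ITS OWN CENTRAL WINDOW, SO THE
# BLIND PRIVATE CHART READ AT ITS OWN AVERAGE RETURNS IT — `Ψ(Ū(U), ext_{U₀}(U|off β)) = U` and the indicator is `1` — and the loops of print's chart point `pert Vk x` are within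
# `(d+2)L·(e^{3|x|} − 1)` of those of `V^{(k)}` ([I] (2.4)∕(2.10) pp.266–267: «V = V′V^{(k)}», the fibre over `U_{k+1}` parametrised by the remaining variables)

Cell `ym-nodeO-ideate`, porter seat PT-A-1 (gen 10); `--kind proof --supports stmt-QuantumFields-27930 --as helper`; count-neutral.  [I] = [Balaban1987RG1]; [B7] = [Balaban1985Averaging].
Over ✓`…PortS1FibreGraphPointCoords` (`theta_apply_avg_eq_centralBond_of_leftInverse`), ✓`…PortS1ChartBlind` (resampling algebra), dag-n18 ✓`…N18LoopLipschitz.norm_holAt_sub_holAt_le_of_forall`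
(walk-local holonomy Lipschitz bound), ✓`…PortS1QtCHol.norm_pertC_mul_star_sub_one_le`, dag-n09-w6 ✓`…N09CentralWindowAtRecord.self_mem_centralWindow_iff`.

WHAT IS PROVED (0 `def`).
* §1 ★ `dist1_loopHol_le_add_of_norm_sub_le` (any `SU(n)`): bondwise `‖U(b) − U′(b)‖ ≤ ε` ⇒ `dist1 (loopHol U c i) ≤ dist1 (loopHol U′ c i) + (d+2)L·ε`;
  `norm_coe_pert_sub_coe_le` (`‖↑(pert Vk x)(b) − ↑Vk(b)‖ ≤ e^{3‖x‖} − 1`), ★ `dist1_loopHol_pert_le` (`dist1 (loopHol (pert Vk x) c i) ≤ dist1 (loopHol Vk c i) + (d+2)L·(e^{3‖x‖} − 1)`).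
* §2 (generic `SU(N)`, any blind per-bond bundle with `T = image` and the window-form left inverse) ★★ `mem_image_of_loops_le` (the own average is in the image window: `Ū(U)(c) ∈ T_c(ext U|off)`),
  ★★★ `privateChart_at_own_avg_eq_self` — `extend β (c ↦ ϑ_c(ext_{U₀}(U|off), Ū(U)(c))) (ext_{U₀}(U|off)) = U` whenever every loop of `U` is `α`-small: THE SOLVED CENTRAL VALUES ARE `U`'s OWN.
* §3 ★★ `privateChart_at_avg_graphPoint_eq` — the same read at `V := Ū(V^{(k)})` for a chart point `U := pert Vk x` ON THE FIBRE (`Ū(U) = Ū(Vk)`, e.g. ✓`avg_pert_recordReparamOf_recordCopFluct_eq`'s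
  graph point `x = Y_g(C·y)`), with the loop budget `α_V + (d+2)L·(e^{3‖x‖} − 1) ≤ α` displayed.

HONEST FRAMING.  Elementary holonomy∕chart bookkeeping (telescoping products of unitaries; left inverses on injectivity windows); the (B-★) assembly, the density in coordinates ((B-d′)) and the
(T2) algebra are NOT here; nothing of (2.10)–(2.14)'s estimates; `FEChartLawStep`∕`FEStepReg` inhabited nowhere; `stub_P0C`∕`stub_LZhalfReg`∕`stub_FEstepReg` OPEN; ⟨27930⟩ OPEN 1∕4; NODE O 0∕1;
COUNT 8∕28 · K 1∕4 UNMOVED; finite `𝕋⁴_{L^K}` at fixed ε — NOT continuum ∕ OS; **the Yang–Mills mass gap (Clay) is NOT proved by any of this.**  No `sorry`, no `def`, no `instance`; standard axioms only.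
-/

noncomputable section

open scoped BigOperators Matrix.Norms.L2Operator Topology
open Set Metric Filter Function

namespace Summit.QuantumFields.YangMills.Theorems.BalabanUVNodesPortS1

open Summit.QuantumFields.YangMills.Theorems.K0RecordFormatNames
open Literature.MathematicalPhysics.QuantumFieldTheory.Balaban1983to89
open Literature.MathematicalPhysics.QuantumFieldTheory.Balaban1983to89.Node00
open Literature.MathematicalPhysics.QuantumFieldTheory.Balaban1983to89.T4Continuum (T4Family)
open Literature.MathematicalPhysics.QuantumFieldTheory.Balaban1983to89.BlockAveraging (avgFun loopHol Small Idx)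
open Literature.MathematicalPhysics.QuantumFieldTheory.Balaban1983to89.BlockAveragingHaarAC (centralBond pre post centralBond_injective)
open Literature.MathematicalPhysics.QuantumFieldTheory.Balaban1983to89.BlockAveragingEMLHaarAC (fibreFamily)
open Literature.MathematicalPhysics.QuantumFieldTheory.Balaban1983to89.ExpMeanLog (expMeanLogSU)
open Summit.QuantumFields.YangMills.BalabanUVNodes.N09CentralWindowAtRecord (self_mem_centralWindow_iff)
open Summit.QuantumFields.YangMills.Theorems.BalabanUVNodesN11TransportOfRecordInPrivateCoordinateChart (succ_le_m_add_K)
open _root_.Matrix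

/-! ## §1  Loops of a bondwise perturbation; loops of print's chart point -/

section Loops

variable {P : Params} {j : ℕ} {n : Type*} [Fintype n] [DecidableEq n] [Nonempty n]

/-- ★ **THE (0.4) LOOP VARIABLES ARE `(d+2)L`-LIPSCHITZ IN THE CONFIGURATION, BONDWISE**: `‖U(b) − U′(b)‖ ≤ ε` for every bond ⇒ `dist1 (loopHol U c i) ≤ dist1 (loopHol U′ c i) + (d+2)L·ε`
(telescoping a product of at most `(d+2)L` unitaries; dag-n18's walk-local bound by name). [cite: Balaban1985Averaging, Prop. 3 p.36, (122)–(123) p.36; Balaban1987RG1, (0.4) p.253] -/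
theorem dist1_loopHol_le_add_of_norm_sub_le (U U' : GaugeField P j (Matrix.specialUnitaryGroup n ℂ)) {ε : ℝ} (hε : 0 ≤ ε)
    (h : ∀ b : PBond P j, ‖((U b : Matrix.specialUnitaryGroup n ℂ) : Matrix n n ℂ) - ((U' b : Matrix.specialUnitaryGroup n ℂ) : Matrix n n ℂ)‖ ≤ ε)
    (c : PBond P (j + 1)) (i : Idx P) :
    dist1 (loopHol U c i) ≤ dist1 (loopHol U' c i) + (((P.d + 2) * P.L : ℕ) : ℝ) * ε := by
  rw [FederbushMean.dist1_SU_eq, FederbushMean.dist1_SU_eq]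
  unfold loopHol
  set γ := T4Continuum.walk (emb c.src) (T4Continuum.loopWord P.L c.dir (BlockAveraging.off i.1) i.2.1 i.2.2) with hγ
  have hlip := YMDAG.N18.HolonomyLipschitz.norm_holAt_sub_holAt_le_of_forall U U' γ (fun s _ => h s.bond)
  have hlen : (γ.length : ℝ) ≤ (((P.d + 2) * P.L : ℕ) : ℝ) := by
    rw [hγ, BlockAveragingEMLLinearised.length_walk]
    exact_mod_cast LatticeWordStokes.length_loopWord_le c i
  calc ‖((T4Continuum.holAt U γ : Matrix.specialUnitaryGroup n ℂ) : Matrix n n ℂ) - 1‖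
      = ‖(((T4Continuum.holAt U' γ : Matrix.specialUnitaryGroup n ℂ) : Matrix n n ℂ) - 1) +
          (((T4Continuum.holAt U γ : Matrix.specialUnitaryGroup n ℂ) : Matrix n n ℂ) - ((T4Continuum.holAt U' γ : Matrix.specialUnitaryGroup n ℂ) : Matrix n n ℂ))‖ := by
        congr 1; abel
    _ ≤ ‖((T4Continuum.holAt U' γ : Matrix.specialUnitaryGroup n ℂ) : Matrix n n ℂ) - 1‖ +
          ‖((T4Continuum.holAt U γ : Matrix.specialUnitaryGroup n ℂ) : Matrix n n ℂ) - ((T4Continuum.holAt U' γ : Matrix.specialUnitaryGroup n ℂ) : Matrix n n ℂ)‖ := norm_add_le _ _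
    _ ≤ _ := by
        refine add_le_add le_rfl (hlip.trans ?_)
        exact mul_le_mul_of_nonneg_right hlen hε

end Loops

section Pert

variable (F : T4Family)

/-- `‖↑(pert Vk x)(b) − ↑Vk(b)‖ ≤ e^{3‖x‖} − 1` (`pert b = exp(X_b)·Vk b`, `‖X_b‖ ≤ 3‖x‖`, `‖Vk b‖ = 1`). [cite: Balaban1987RG1, (2.4) p.266; Balaban1985Averaging, (24) p.21] -/
theorem norm_coe_pert_sub_coe_le (k K : ℕ) (Vk : GaugeField (F.P K) k (SU 2)) (x : FluctIdx F k K → ℝ) (b : PBond (F.P K) k) :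
    ‖((pert F k K Vk x b : SU 2) : MatA 2) - ((Vk b : SU 2) : MatA 2)‖ ≤ Real.exp (3 * ‖x‖) - 1 := by
  have hco : ((pert F k K Vk x b : SU 2) : MatA 2) = pertC F k K Vk (fun i => (x i : ℂ)) b := by
    rw [pertC_ofReal]; rfl
  have hV : ((Vk b : SU 2) : MatA 2) * star ((Vk b : SU 2) : MatA 2) = 1 := (Matrix.mem_unitaryGroup_iff).1 (Vk b).2.1
  have hfac : ((pert F k K Vk x b : SU 2) : MatA 2) - ((Vk b : SU 2) : MatA 2) =
      (pertC F k K Vk (fun i => (x i : ℂ)) b * star ((Vk b : SU 2) : MatA 2) - 1) * ((Vk b : SU 2) : MatA 2) := by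
    rw [sub_mul, one_mul, mul_assoc, (Matrix.mem_unitaryGroup_iff').1 (Vk b).2.1, mul_one, hco]
  rw [hfac]
  refine (norm_mul_le _ _).trans ?_
  have h1 : ‖((Vk b : SU 2) : MatA 2)‖ ≤ 1 := (CStarRing.norm_of_mem_unitary (Vk b).2.1).le
  have h2 := norm_pertC_mul_star_sub_one_le F k K Vk (fun i => (x i : ℂ)) b
  rw [norm_ofReal_pi_eq] at h2
  have h0 : 0 ≤ Real.exp (3 * ‖x‖) - 1 := by
    have := Real.add_one_le_exp (3 * ‖x‖); nlinarith [norm_nonneg x]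
  calc ‖pertC F k K Vk (fun i => (x i : ℂ)) b * star ((Vk b : SU 2) : MatA 2) - 1‖ * ‖((Vk b : SU 2) : MatA 2)‖
      ≤ (Real.exp (3 * ‖x‖) - 1) * 1 := mul_le_mul h2 h1 (norm_nonneg _) h0
    _ = Real.exp (3 * ‖x‖) - 1 := mul_one _

/-- ★ **THE LOOPS OF PRINT's CHART POINT**: `dist1 (loopHol (pert Vk x) c i) ≤ dist1 (loopHol Vk c i) + (d+2)L·(e^{3‖x‖} − 1)`. [cite: Balaban1987RG1, (2.4) p.266, (0.4) p.253; Balaban1985Averaging, Prop. 3 p.36] -/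
theorem dist1_loopHol_pert_le (k K : ℕ) (Vk : GaugeField (F.P K) k (SU 2)) (x : FluctIdx F k K → ℝ) (c : PBond (F.P K) (k + 1)) (i : Idx (F.P K)) :
    dist1 (loopHol (pert F k K Vk x) c i) ≤ dist1 (loopHol Vk c i) + ((((F.P K).d + 2) * (F.P K).L : ℕ) : ℝ) * (Real.exp (3 * ‖x‖) - 1) := by
  have h0 : 0 ≤ Real.exp (3 * ‖x‖) - 1 := by
    have := Real.add_one_le_exp (3 * ‖x‖); nlinarith [norm_nonneg x]
  exact dist1_loopHol_le_add_of_norm_sub_le (pert F k K Vk x) Vk h0 (fun b => norm_coe_pert_sub_coe_le F k K Vk x b) c i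

end Pert

/-! ## §2  A configuration with α-small loops is returned by the blind private chart read at its own average -/

section OwnWindow

variable {F : T4Family} {N : ℕ} [NeZero N] {K k : ℕ}

omit [NeZero N] in
/-- The off-central part of `U` extended by the dummies `U₀` IS `U` resampled with the private datum `c ↦ U₀(β c)`. [cite: Balaban1987RG1, (2.10) p.267 (bookkeeping)] -/
theorem ext_off_eq_extend (hk : k < K) (U U₀ : GaugeField (F.P K) k (SU N)) :
    (fun b => if h : b ∈ Set.range (centralBond : PBond (F.P K) (k + 1) → PBond (F.P K) k) then U₀ b
      else (fun b' : {b : PBond (F.P K) k // ¬ b ∈ Set.range (centralBond : PBond (F.P K) (k + 1) → PBond (F.P K) k)} => U b'.1) ⟨b, h⟩) =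
      extend centralBond (fun c => U₀ (centralBond c)) U := by
  have hβ : Injective (centralBond : PBond (F.P K) (k + 1) → PBond (F.P K) k) := centralBond_injective (succ_le_m_add_K hk)
  funext b
  by_cases h : ∃ c, centralBond c = b
  · obtain ⟨c, rfl⟩ := h
    rw [dif_pos ⟨c, rfl⟩, hβ.extend_apply]
  · rw [dif_neg (fun ⟨c, hc⟩ => h ⟨c, hc⟩), extend_apply' _ _ _ h]

omit [NeZero N] in
/-- Resampling `U` with its own private data gives `U` back. [folklore] -/
theorem extend_self_private (hk : k < K) (U : GaugeField (F.P K) k (SU N)) :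
    extend centralBond (fun c => U (centralBond c)) U = U := by
  have hβ : Injective (centralBond : PBond (F.P K) (k + 1) → PBond (F.P K) k) := centralBond_injective (succ_le_m_add_K hk)
  funext b
  by_cases h : ∃ c, centralBond c = b
  · obtain ⟨c, rfl⟩ := h
    rw [hβ.extend_apply]
  · rw [extend_apply' _ _ _ h]

/-- ★★ **THE OWN AVERAGE IS IN THE IMAGE WINDOW**: if every loop of `U` at `c` is `α`-small then `Ū(U)(c) ∈ T_c(U′)` for every `U′` agreeing with `U` off the central bonds, for a blind bundle
with `T = image of the central α-window` (`U(β c)` is in `U`'s window — dag-n09-w6's `self_mem_centralWindow_iff` — and maps to `Ū(U)(c)`). [cite: Balaban1987RG1, (0.4) p.253, (2.9)–(2.10) pp.266–267] -/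
theorem mem_image_of_loops_le (hk : k < K) {α : ℝ}
    {T : PBond (F.P K) (k + 1) → GaugeField (F.P K) k (SU N) → Set (SU N)}
    (hTim : ∀ c U, T c U = (fun g => (avOfRecord F N K k).avg (update U (centralBond c) g) c) ''
      {g : SU N | ∀ i : Idx (F.P K), dist1 (fibreFamily U c (pre U c * g * post U c) i) ≤ α})
    (hTbl : ∀ c U (g : PBond (F.P K) (k + 1) → SU N), T c (extend centralBond g U) = T c U)
    (U : GaugeField (F.P K) k (SU N)) (g : PBond (F.P K) (k + 1) → SU N) (c : PBond (F.P K) (k + 1))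
    (hU : ∀ i : Idx (F.P K), dist1 (loopHol U c i) ≤ α) :
    (avOfRecord F N K k).avg U c ∈ T c (extend centralBond g U) := by
  rw [hTbl, hTim]
  refine ⟨U (centralBond c), (self_mem_centralWindow_iff (succ_le_m_add_K hk) U c α).2 hU, ?_⟩
  show (avOfRecord F N K k).avg (update U (centralBond c) (U (centralBond c))) c = (avOfRecord F N K k).avg U c
  rw [update_eq_self]

/-- ★★★ **THE BLIND PRIVATE CHART READ AT A CONFIGURATION's OWN AVERAGE RETURNS THE CONFIGURATION**: for a blind bundle whose `ϑ_c(U,·)` is a left inverse of the one-variable map on the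
central α-window, every `U` all of whose loops are `α`-small, and every dummy `U₀`: `extend β (c ↦ ϑ_c(Ū′, Ū(U)(c))) Ū′ = U`, `Ū′ = ext_{U₀}(U|off β) = extend β (U₀ ∘ β) U` — the solved
central values ARE `U`'s own central values. [cite: Balaban1987RG1, (2.10) p.267, p.268 («the variables V′(b₀(c)) are determined by …»)] -/
theorem privateChart_at_own_avg_eq_self (hk : k < K) {α : ℝ}
    {ϑ : PBond (F.P K) (k + 1) → GaugeField (F.P K) k (SU N) → SU N → SU N}
    (hleft : ∀ c U g, (∀ i : Idx (F.P K), dist1 (fibreFamily U c (pre U c * g * post U c) i) ≤ α) →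
      ϑ c U ((avOfRecord F N K k).avg (update U (centralBond c) g) c) = g)
    (hθbl : ∀ c U (g : PBond (F.P K) (k + 1) → SU N), ϑ c (extend centralBond g U) = ϑ c U)
    (U U₀ : GaugeField (F.P K) k (SU N)) (hU : ∀ (c : PBond (F.P K) (k + 1)) (i : Idx (F.P K)), dist1 (loopHol U c i) ≤ α) :
    extend centralBond (fun c => ϑ c (extend centralBond (fun c => U₀ (centralBond c)) U) ((avOfRecord F N K k).avg U c))
      (extend centralBond (fun c => U₀ (centralBond c)) U) = U := by
  have hβ : Injective (centralBond : PBond (F.P K) (k + 1) → PBond (F.P K) k) := centralBond_injective (succ_le_m_add_K hk)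
  have hθ : ∀ c, ϑ c (extend centralBond (fun c => U₀ (centralBond c)) U) ((avOfRecord F N K k).avg U c) = U (centralBond c) := by
    intro c
    rw [hθbl]
    have h := hleft c U (U (centralBond c)) ((self_mem_centralWindow_iff (succ_le_m_add_K hk) U c α).2 (hU c))
    rwa [update_eq_self] at h
  simp_rw [hθ]
  rw [extend_extend_eq_extend hβ]
  exact extend_self_private hk U

end OwnWindow

/-! ## §3  At print's chart point on the fibre over `Ū(V^{(k)})` -/

section GraphPoint

variable (F : T4Family) {K k : ℕ}

/-- ★★ **THE BLIND PRIVATE CHART AT `V := Ū(V^{(k)})` READ AT A CHART POINT `U := pert Vk x` ON THE FIBRE RETURNS IT, AND THE INDICATOR IS `1`**, provided the loop budget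
`dist1 (loopHol Vk c i) + (d+2)L·(e^{3‖x‖} − 1) ≤ α` (so `U`'s loops are `α`-small, §1).  With `x := Y_g(C·y)` and ✓`avg_pert_recordReparamOf_recordCopFluct_eq` this is the identification
of N11's solved central values with print's explicit ones on the whole flat window. [cite: Balaban1987RG1, (2.4) p.266, (2.10) p.267, p.268] -/
theorem privateChart_at_avg_graphPoint_eq (hk : k < K) {α : ℝ}
    {T : PBond (F.P K) (k + 1) → GaugeField (F.P K) k (SU 2) → Set (SU 2)}
    {ϑ : PBond (F.P K) (k + 1) → GaugeField (F.P K) k (SU 2) → SU 2 → SU 2}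
    (hTim : ∀ c U, T c U = (fun g => (avOfRecord F 2 K k).avg (update U (centralBond c) g) c) ''
      {g : SU 2 | ∀ i : Idx (F.P K), dist1 (fibreFamily U c (pre U c * g * post U c) i) ≤ α})
    (hTbl : ∀ c U (g : PBond (F.P K) (k + 1) → SU 2), T c (extend centralBond g U) = T c U)
    (hleft : ∀ c U g, (∀ i : Idx (F.P K), dist1 (fibreFamily U c (pre U c * g * post U c) i) ≤ α) →
      ϑ c U ((avOfRecord F 2 K k).avg (update U (centralBond c) g) c) = g)
    (hθbl : ∀ c U (g : PBond (F.P K) (k + 1) → SU 2), ϑ c (extend centralBond g U) = ϑ c U)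
    (Vk : GaugeField (F.P K) k (SU 2)) (x : FluctIdx F k K → ℝ) (U₀ : GaugeField (F.P K) k (SU 2))
    (havg : ∀ c, (avOfRecord F 2 K k).avg (pert F k K Vk x) c = (avOfRecord F 2 K k).avg Vk c)
    (hbudget : ∀ (c : PBond (F.P K) (k + 1)) (i : Idx (F.P K)),
      dist1 (loopHol Vk c i) + ((((F.P K).d + 2) * (F.P K).L : ℕ) : ℝ) * (Real.exp (3 * ‖x‖) - 1) ≤ α) :
    (∀ c, (avOfRecord F 2 K k).avg Vk c ∈ T c (extend centralBond (fun c => U₀ (centralBond c)) (pert F k K Vk x))) ∧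
      extend centralBond (fun c => ϑ c (extend centralBond (fun c => U₀ (centralBond c)) (pert F k K Vk x)) ((avOfRecord F 2 K k).avg Vk c))
        (extend centralBond (fun c => U₀ (centralBond c)) (pert F k K Vk x)) = pert F k K Vk x := by
  have hU : ∀ (c : PBond (F.P K) (k + 1)) (i : Idx (F.P K)), dist1 (loopHol (pert F k K Vk x) c i) ≤ α :=
    fun c i => (dist1_loopHol_pert_le F k K Vk x c i).trans (hbudget c i)
  refine ⟨fun c => ?_, ?_⟩
  · rw [← havg c]
    exact mem_image_of_loops_le hk hTim hTbl _ _ c (hU c)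
  · have h := privateChart_at_own_avg_eq_self hk hleft hθbl (pert F k K Vk x) U₀ hU
    simp_rw [havg] at h
    exact h

end GraphPoint

end Summit.QuantumFields.YangMills.Theorems.BalabanUVNodesPortS1

end
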